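import Summits.HubbardSuperconductivity.HubbardSuperconductivity.Theorems.AnisotropyChordTransferFibre3TwoHoleBSCertSound
import Summits.HubbardSuperconductivity.HubbardSuperconductivity.Theorems.AnisotropyChordTransferFibre3TwoHoleBSMargin

/-!
# Route `AnisotropyChord` / H0 rotor rung: CERTIFIED ENCLOSURES of the skeleton constants `s`, `‖x‖²` and of the charge `ℓ¹`-norm — inverse-free, from the CND constant `η` and one rational test vector

Sixteenth file of the `TwoHoleBS` (PROP BS) chain.  The explicit-threshold near-pair certificate
(`…TwoHoleBSMargin.dualCert_threeQuarter_near_of_gap`, p1's `…NearTailSharp.dualCert_threeQuarter_near_window`) needs NUMBERS: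
the harmonic-measure mass `s = 1ᵀA⁻¹1`, `‖x_B‖²`, and a constant `K` with `(Σ_p|(E(Λ)ŵ)_p|)² ≤ K‖w‖²`.  All involve `A⁻¹`; here they
are enclosed WITHOUT inverting `A`, from the strict conditional negative definiteness constant `η` (certified in
`…TwoHoleBSCertSound`) and a rational test vector `c ≈ x/s` with `Σc = 1`:
* `quad_le_inv_svec2` (`cᵀAc ≤ 1/s` for `Σc = 1`), ★ `inv_svec2_le` (`1/s ≤ cᵀAc + ‖Ac − μ1‖²/η`), ★ `xs_sub_sq_le`
  (`η²‖x/s − c‖² ≤ ‖Ac − μ1‖²`), `normSq_smInvInf_le` (`η²‖E∞y‖² ≤ ‖y‖²`), `xvec2_sq_le` (`‖x‖² ≤ s²(N̄ + ρ̄)²`);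
* ★★ `l1_charge_sq_le`: for `Λs ≥ 2`, `(Σ_p|(E(Λ)ŵ)_p|)² ≤ 10((1+θ)/η² + (1+1/θ)X²/s₋²)·‖w‖²` (any `θ > 0`; `‖x‖² ≤ X`, `s ≥ s₋`);
* computable `fQ`, `r2Q`, `n2Q`, ★ `boundsCert d c μ Fm Fp R N̄ ρ̄ η : Bool` (its soundness `bounds_of_boundsCert` and the
  margin monotonicity `mLow_le_liftMargin` are in the next file `…Fibre3TwoHoleBSBoundsSound`).
Prover seat `hubbard-h0-rotor-p2` g3; helper for stmt-HubbardSuperconductivity-19089 (`--supports`, helper class).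
WHAT THIS IS NOT: nothing here proves superconductivity in the Hubbard model; the rotor TARGET as originally worded stays
FALSE (g15 verdict).  Numerical plumbing for ONE input (HOLE₂ near-pair tail constants) of ONE conditional reduction (rung 19089).
Mathlib + tree imports only; no sorry, no axioms.
-/

set_option linter.dupNamespace false
set_option autoImplicit false

namespace Summit.HubbardSuperconductivity.HubbardSuperconductivity.Theorems.AnisotropyChord.Transfer.Fibre3

namespace TwoHoleBS

open Subsample
open scoped BigOperators

/-! ## Computable layer: the test-vector functionals at parameter `u` -/

/-- entry of a rational vector given as a list. [folklore] -/
def getV (c : List ℚ) (i : ℕ) : ℚ := c.getD i 0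

/-- `f(u) = cᵀA(u)c`. [folklore] -/
def fQ (d : ℤ × ℤ) (c : List ℚ) (u : ℚ) : ℚ := sumR 10 fun k => sumR 10 fun l => getV c k * AgetQ d u k l * getV c l

/-- `r²(u) = ‖A(u)c − μ1‖²`. [folklore] -/
def r2Q (d : ℤ × ℤ) (c : List ℚ) (μ u : ℚ) : ℚ := sumR 10 fun k => (sumR 10 (fun l => AgetQ d u k l * getV c l) - μ) ^ 2

/-- `‖c‖²`. [folklore] -/
def n2Q (c : List ℚ) : ℚ := sumR 10 fun k => getV c k ^ 2

/-- ★ the bounds certificate: `Σc = 1`; at both endpoints `Fm ≤ f ≤ Fp`, `r² ≤ R`; `N̄ ≥ 0`, `N̄² ≥ ‖c‖²`; `ρ̄ ≥ 0`, `η²ρ̄² ≥ R`;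
`0 < Fm`, `0 < η`. [folklore] -/
def boundsCert (d : ℤ × ℤ) (c : List ℚ) (μ Fm Fp R Nb ρb η : ℚ) : Bool :=
  decide (sumR 10 (getV c) = 1) &&
  decide (Fm ≤ fQ d c uLo) && decide (fQ d c uLo ≤ Fp) && decide (Fm ≤ fQ d c uHi) && decide (fQ d c uHi ≤ Fp) &&
  decide (r2Q d c μ uLo ≤ R) && decide (r2Q d c μ uHi ≤ R) &&
  decide (0 ≤ Nb) && decide (n2Q c ≤ Nb ^ 2) && decide (0 ≤ ρb) && decide (R ≤ η ^ 2 * ρb ^ 2) &&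
  decide (0 < Fm) && decide (0 < η)

/-! ## Generic inverse-free enclosures -/

section Generic

variable (A : Matrix (Fin 5 ⊕ Fin 5) (Fin 5 ⊕ Fin 5) ℝ)

/-- `cᵀAc ≤ 1/s` for `Σc = 1` (CND, `Ax = 1`, `Σx = s ≠ 0`). [folklore] -/
theorem quad_le_inv_svec2 (hsymm : A.IsSymm) (hA : IsUnit A.det) (hs : TwoChannel.svec2 A ≠ 0)
    (hcnd0 : ∀ c : Fin 5 ⊕ Fin 5 → ℝ, ∑ r, c r = 0 → dotProduct c (A.mulVec c) ≤ 0)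
    (c : Fin 5 ⊕ Fin 5 → ℝ) (hc : ∑ r, c r = 1) :
    dotProduct c (A.mulVec c) ≤ 1 / TwoChannel.svec2 A := by
  set x := TwoChannel.xvec2 A with hx
  set s := TwoChannel.svec2 A with hsdef
  have hAx : A.mulVec x = fun _ => 1 := mulVec_xvec2 A hA
  have hs_sum : ∑ r, x r = s := rfl
  set z : Fin 5 ⊕ Fin 5 → ℝ := (1 / s) • x - c with hz
  have hzsum : ∑ r, z r = 0 := by
    simp only [hz, Pi.sub_apply, Pi.smul_apply, smul_eq_mul, Finset.sum_sub_distrib, ← Finset.mul_sum, hs_sum, hc]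
    rw [one_div_mul_cancel hs, sub_self]
  have hxAx : dotProduct x (A.mulVec x) = s := by rw [hAx]; simp [dotProduct, hs_sum]
  have hcAx : dotProduct c (A.mulVec x) = 1 := by rw [hAx]; simp [dotProduct, hc]
  have hxAc : dotProduct x (A.mulVec c) = 1 := by
    rw [Matrix.dotProduct_mulVec, ← Matrix.mulVec_transpose, hsymm.eq, dotProduct_comm, hcAx]
  have hq : dotProduct z (A.mulVec z) = dotProduct c (A.mulVec c) - 1 / s := by
    rw [hz, Matrix.mulVec_sub, Matrix.mulVec_smul, sub_dotProduct, dotProduct_sub, dotProduct_sub, smul_dotProduct,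
      smul_dotProduct, dotProduct_smul, dotProduct_smul, hxAx, hcAx, hxAc]
    simp only [smul_eq_mul]
    field_simp
    ring
  have := hcnd0 z hzsum
  linarith

/-- ★ `1/s ≤ cᵀAc + ‖Ac − μ1‖²/η` for `Σc = 1` (strict CND with constant `η`; any `μ`). [folklore] -/
theorem inv_svec2_le (hsymm : A.IsSymm) (hA : IsUnit A.det) (hs : TwoChannel.svec2 A ≠ 0) (η : ℝ) (hη : 0 < η)
    (hcnd : ∀ c : Fin 5 ⊕ Fin 5 → ℝ, ∑ r, c r = 0 → dotProduct c (A.mulVec c) ≤ -η * dotProduct c c)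
    (c : Fin 5 ⊕ Fin 5 → ℝ) (hc : ∑ r, c r = 1) (μ : ℝ) :
    1 / TwoChannel.svec2 A ≤ dotProduct c (A.mulVec c)
      + dotProduct (A.mulVec c - μ • fun _ => 1) (A.mulVec c - μ • fun _ => 1) / η := by
  set x := TwoChannel.xvec2 A with hx
  set s := TwoChannel.svec2 A with hsdef
  have hAx : A.mulVec x = fun _ => 1 := mulVec_xvec2 A hA
  have hs_sum : ∑ r, x r = s := rfl
  set z : Fin 5 ⊕ Fin 5 → ℝ := (1 / s) • x - c with hz
  set v : Fin 5 ⊕ Fin 5 → ℝ := A.mulVec c - μ • fun _ => 1 with hv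
  have hzsum : ∑ r, z r = 0 := by
    simp only [hz, Pi.sub_apply, Pi.smul_apply, smul_eq_mul, Finset.sum_sub_distrib, ← Finset.mul_sum, hs_sum, hc]
    rw [one_div_mul_cancel hs, sub_self]
  have hz1 : dotProduct z (fun _ => (1 : ℝ)) = 0 := by simp [dotProduct, hzsum]
  -- expansion around `c`: `f(x/s) = f(c) + 2 zᵀAc + zᵀAz`
  have hxAx : dotProduct x (A.mulVec x) = s := by rw [hAx]; simp [dotProduct, hs_sum]
  have hfx : dotProduct ((1 / s) • x) (A.mulVec ((1 / s) • x)) = 1 / s := by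
    rw [Matrix.mulVec_smul, smul_dotProduct, dotProduct_smul, hxAx]
    simp only [smul_eq_mul]
    field_simp
  have hsym : dotProduct c (A.mulVec z) = dotProduct z (A.mulVec c) := by
    rw [Matrix.dotProduct_mulVec, ← Matrix.mulVec_transpose, hsymm.eq, dotProduct_comm]
  have hexp : 1 / s = dotProduct c (A.mulVec c) + 2 * dotProduct z (A.mulVec c) + dotProduct z (A.mulVec z) := by
    have e : (1 / s) • x = c + z := by rw [hz]; abel
    rw [← hfx, e, Matrix.mulVec_add, add_dotProduct, dotProduct_add, dotProduct_add, hsym]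
    ring
  -- `zᵀAc = zᵀ(Ac − μ1)`
  have hzv : dotProduct z (A.mulVec c) = dotProduct z v := by
    rw [hv, dotProduct_sub, dotProduct_smul, hz1, smul_zero, sub_zero]
  have hcz := hcnd z hzsum
  -- Young: `2η z·v ≤ η² z·z + v·v`
  have hyoung : 2 * η * dotProduct z v ≤ η ^ 2 * dotProduct z z + dotProduct v v := by
    have h0 : 0 ≤ dotProduct (η • z - v) (η • z - v) := Finset.sum_nonneg fun i _ => mul_self_nonneg _
    have e : dotProduct (η • z - v) (η • z - v) = η ^ 2 * dotProduct z z - 2 * η * dotProduct z v + dotProduct v v := by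
      simp only [sub_dotProduct, dotProduct_sub, smul_dotProduct, dotProduct_smul, smul_eq_mul, dotProduct_comm v z]
      ring
    linarith
  rw [hexp, hzv]
  have h1 : 2 * dotProduct z v + dotProduct z (A.mulVec z) ≤ dotProduct v v / η := by
    rw [le_div_iff₀ hη]
    nlinarith
  linarith

/-- ★ `η²‖x/s − c‖² ≤ ‖Ac − μ1‖²` (so `x/s` is within `r/η` of the test vector). [folklore] -/
theorem xs_sub_sq_le (hsymm : A.IsSymm) (hA : IsUnit A.det) (hs : TwoChannel.svec2 A ≠ 0) (η : ℝ) (hη : 0 < η)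
    (hcnd : ∀ c : Fin 5 ⊕ Fin 5 → ℝ, ∑ r, c r = 0 → dotProduct c (A.mulVec c) ≤ -η * dotProduct c c)
    (c : Fin 5 ⊕ Fin 5 → ℝ) (hc : ∑ r, c r = 1) (μ : ℝ) :
    η ^ 2 * dotProduct ((1 / TwoChannel.svec2 A) • TwoChannel.xvec2 A - c) ((1 / TwoChannel.svec2 A) • TwoChannel.xvec2 A - c)
      ≤ dotProduct (A.mulVec c - μ • fun _ => 1) (A.mulVec c - μ • fun _ => 1) := by
  set x := TwoChannel.xvec2 A with hx
  set s := TwoChannel.svec2 A with hsdef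
  have hAx : A.mulVec x = fun _ => 1 := mulVec_xvec2 A hA
  have hs_sum : ∑ r, x r = s := rfl
  set z : Fin 5 ⊕ Fin 5 → ℝ := (1 / s) • x - c with hz
  have hzsum : ∑ r, z r = 0 := by
    simp only [hz, Pi.sub_apply, Pi.smul_apply, smul_eq_mul, Finset.sum_sub_distrib, ← Finset.mul_sum, hs_sum, hc]
    rw [one_div_mul_cancel hs, sub_self]
  have hcnd0 : ∀ c : Fin 5 ⊕ Fin 5 → ℝ, ∑ r, c r = 0 → dotProduct c (A.mulVec c) ≤ 0 := by
    intro c' hc'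
    have h1 := hcnd c' hc'
    have h2 : 0 ≤ dotProduct c' c' := Finset.sum_nonneg fun i _ => mul_self_nonneg _
    nlinarith
  -- `zᵀAz = f(c) − 1/s`
  have hxAx : dotProduct x (A.mulVec x) = s := by rw [hAx]; simp [dotProduct, hs_sum]
  have hcAx : dotProduct c (A.mulVec x) = 1 := by rw [hAx]; simp [dotProduct, hc]
  have hxAc : dotProduct x (A.mulVec c) = 1 := by
    rw [Matrix.dotProduct_mulVec, ← Matrix.mulVec_transpose, hsymm.eq, dotProduct_comm, hcAx]
  have hq : dotProduct z (A.mulVec z) = dotProduct c (A.mulVec c) - 1 / s := by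
    rw [hz, Matrix.mulVec_sub, Matrix.mulVec_smul, sub_dotProduct, dotProduct_sub, dotProduct_sub, smul_dotProduct,
      smul_dotProduct, dotProduct_smul, dotProduct_smul, hxAx, hcAx, hxAc]
    simp only [smul_eq_mul]
    field_simp
    ring
  have h1 := hcnd z hzsum
  have h2 := inv_svec2_le A hsymm hA hs η hη hcnd c hc μ
  -- `η‖z‖² ≤ −zᵀAz = 1/s − f(c) ≤ r²/η`
  have h3 : η * dotProduct z z ≤ dotProduct (A.mulVec c - μ • fun _ => 1) (A.mulVec c - μ • fun _ => 1) / η := by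
    linarith
  rw [le_div_iff₀ hη] at h3
  nlinarith

/-- `η²‖E∞y‖² ≤ ‖y‖²`. [folklore] -/
theorem normSq_smInvInf_le (hsymm : A.IsSymm) (hA : IsUnit A.det) (hs : TwoChannel.svec2 A ≠ 0) (η : ℝ) (hη : 0 < η)
    (hcnd : ∀ c : Fin 5 ⊕ Fin 5 → ℝ, ∑ r, c r = 0 → dotProduct c (A.mulVec c) ≤ -η * dotProduct c c)
    (y : Fin 5 ⊕ Fin 5 → ℝ) :
    η ^ 2 * dotProduct ((smInvInf A).mulVec y) ((smInvInf A).mulVec y) ≤ dotProduct y y := by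
  set c := (smInvInf A).mulVec y with hc
  have hcsum : ∑ r, c r = 0 := sum_smInvInf_mulVec A hsymm hs y
  have hAc : A.mulVec c = -y + (dotProduct (TwoChannel.xvec2 A) y / TwoChannel.svec2 A) • (fun _ => (1 : ℝ)) :=
    mulVec_smInvInf A hA y
  have hc1 : dotProduct c (fun _ => (1 : ℝ)) = 0 := by simp [dotProduct, hcsum]
  have hquad : dotProduct c (A.mulVec c) = -dotProduct c y := by
    rw [hAc, dotProduct_add, dotProduct_neg, dotProduct_smul, hc1, smul_zero, add_zero]
  have h1 := hcnd c hcsum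
  rw [hquad] at h1
  -- `η c·c ≤ c·y ≤ √(c·c)√(y·y)`, squared
  have h2 : η * dotProduct c c ≤ dotProduct c y := by linarith
  have hcc : 0 ≤ dotProduct c c := Finset.sum_nonneg fun i _ => mul_self_nonneg _
  have hcs : (dotProduct c y) ^ 2 ≤ dotProduct c c * dotProduct y y := by
    have := Finset.sum_mul_sq_le_sq_mul_sq Finset.univ c y
    simp only [dotProduct, pow_two] at this ⊢
    exact this
  have h3 : (η * dotProduct c c) ^ 2 ≤ dotProduct c c * dotProduct y y :=
    (pow_le_pow_left₀ (by positivity) h2 2).trans hcs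
  by_cases h0 : dotProduct c c = 0
  · rw [h0, mul_zero]; exact Finset.sum_nonneg fun i _ => mul_self_nonneg _
  · have hpos : 0 < dotProduct c c := lt_of_le_of_ne hcc (Ne.symm h0)
    have : η ^ 2 * dotProduct c c * dotProduct c c ≤ dotProduct y y * dotProduct c c := by nlinarith
    exact le_of_mul_le_mul_right this hpos

/-- `‖x‖² ≤ s²(N̄ + ρ̄)²` from `‖c‖ ≤ N̄`, `‖x/s − c‖ ≤ ρ̄`. [folklore] -/
theorem xvec2_sq_le (c : Fin 5 ⊕ Fin 5 → ℝ) (Nb ρb : ℝ) (hN : 0 ≤ Nb) (hρ : 0 ≤ ρb)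
    (hs : TwoChannel.svec2 A ≠ 0) (hcN : dotProduct c c ≤ Nb ^ 2)
    (hz : dotProduct ((1 / TwoChannel.svec2 A) • TwoChannel.xvec2 A - c) ((1 / TwoChannel.svec2 A) • TwoChannel.xvec2 A - c)
      ≤ ρb ^ 2) :
    dotProduct (TwoChannel.xvec2 A) (TwoChannel.xvec2 A) ≤ TwoChannel.svec2 A ^ 2 * (Nb + ρb) ^ 2 := by
  set x := TwoChannel.xvec2 A with hx
  set s := TwoChannel.svec2 A with hsdef
  set z : Fin 5 ⊕ Fin 5 → ℝ := (1 / s) • x - c with hzdef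
  have hxe : x = s • (c + z) := by
    rw [hzdef, add_sub_cancel, smul_smul, mul_one_div_cancel hs, one_smul]
  have hcz : dotProduct c z ≤ Nb * ρb := by
    have hcs : (dotProduct c z) ^ 2 ≤ dotProduct c c * dotProduct z z := by
      have := Finset.sum_mul_sq_le_sq_mul_sq Finset.univ c z
      simp only [dotProduct, pow_two] at this ⊢
      exact this
    have hzz : 0 ≤ dotProduct z z := Finset.sum_nonneg fun i _ => mul_self_nonneg _
    have h1 : (dotProduct c z) ^ 2 ≤ (Nb * ρb) ^ 2 := by
      rw [mul_pow]
      exact hcs.trans (mul_le_mul hcN hz hzz (sq_nonneg _))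
    exact (le_abs_self _).trans (abs_le_of_sq_le_sq h1 (mul_nonneg hN hρ))
  have hzz : dotProduct z z ≤ ρb ^ 2 := hz
  rw [hxe, smul_dotProduct, dotProduct_smul, smul_eq_mul, smul_eq_mul, add_dotProduct, dotProduct_add, dotProduct_add,
    dotProduct_comm z c]
  have hs2 : 0 ≤ s * s := mul_self_nonneg s
  nlinarith

/-- Young's inequality for squared norms: `‖a + b‖² ≤ (1+θ)‖a‖² + (1+1/θ)‖b‖²`. [folklore] -/
theorem normSq_add_le (a b : Fin 5 ⊕ Fin 5 → ℝ) (θ : ℝ) (hθ : 0 < θ) :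
    dotProduct (a + b) (a + b) ≤ (1 + θ) * dotProduct a a + (1 + 1 / θ) * dotProduct b b := by
  have h0 : 0 ≤ dotProduct (θ • a - b) (θ • a - b) := Finset.sum_nonneg fun i _ => mul_self_nonneg _
  rw [sub_dotProduct, dotProduct_sub, dotProduct_sub, smul_dotProduct, dotProduct_smul, dotProduct_smul, smul_dotProduct,
    dotProduct_comm b a] at h0
  simp only [smul_eq_mul] at h0
  rw [add_dotProduct, dotProduct_add, dotProduct_add, dotProduct_comm b a]
  have ha : 0 ≤ dotProduct a a := Finset.sum_nonneg fun i _ => mul_self_nonneg _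
  have hb : 0 ≤ dotProduct b b := Finset.sum_nonneg fun i _ => mul_self_nonneg _
  have key : 2 * dotProduct a b ≤ θ * dotProduct a a + (1 / θ) * dotProduct b b := by
    rw [show (1 / θ) * dotProduct b b = dotProduct b b / θ by ring]
    have : 2 * dotProduct a b * θ ≤ θ * dotProduct a a * θ + dotProduct b b := by nlinarith
    have h2 : θ * dotProduct a a + dotProduct b b / θ = (θ * dotProduct a a * θ + dotProduct b b) / θ := by
      field_simp
    rw [h2, le_div_iff₀ hθ]
    exact this
  nlinarith

/-- ★★ **THE CHARGE `ℓ¹`-BOUND:** for `Λs ≥ 2`, strict CND with constant `η`, `‖x‖² ≤ X`, `0 < s₋ ≤ s`: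
`(Σ_p |(E(Λ)ŵ)_p|)² ≤ 10((1+θ)/η² + (1+1/θ)X²/s₋²)‖w‖²` for any `θ > 0`. [folklore] -/
theorem l1_charge_sq_le (hsymm : A.IsSymm) (hA : IsUnit A.det) (η : ℝ) (hη : 0 < η)
    (hcnd : ∀ c : Fin 5 ⊕ Fin 5 → ℝ, ∑ r, c r = 0 → dotProduct c (A.mulVec c) ≤ -η * dotProduct c c)
    (hspos : 0 < TwoChannel.svec2 A) (X sl : ℝ) (hsl : 0 < sl) (hsls : sl ≤ TwoChannel.svec2 A)
    (hX : dotProduct (TwoChannel.xvec2 A) (TwoChannel.xvec2 A) ≤ X)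
    (Λ : ℝ) (hΛ : 2 ≤ Λ * TwoChannel.svec2 A) (θ : ℝ) (hθ : 0 < θ) (w : Fin 4 ⊕ Fin 4 → ℝ) :
    (∑ p, |(smInv A Λ).mulVec (pad w) p|) ^ 2
      ≤ 10 * ((1 + θ) / η ^ 2 + (1 + 1 / θ) * X ^ 2 / sl ^ 2) * dotProduct w w := by
  set s := TwoChannel.svec2 A with hsdef
  set x := TwoChannel.xvec2 A with hxdef
  set c := (smInv A Λ).mulVec (pad w) with hc
  set c₁ := (smInvInf A).mulVec (pad w) with hc₁
  set κ := dotProduct x (pad w) / (s * (Λ * s - 1)) with hκ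
  set c₂ : Fin 5 ⊕ Fin 5 → ℝ := κ • x with hc₂
  have hs0 : s ≠ 0 := hspos.ne'
  have hΛ1 : 1 ≤ Λ * s - 1 := by linarith
  have hdec : c = c₁ + c₂ := by
    funext p
    rw [hc, smInv_mulVec_eq_inf A Λ hs0 (by linarith) (pad w) p]
    simp only [Pi.add_apply, hc₁, hc₂, Pi.smul_apply, smul_eq_mul, hκ, dotProduct]
    ring
  -- `(Σ|c|)² ≤ 10‖c‖²`
  have hww : dotProduct (pad w) (pad w) = dotProduct w w := by
    simp only [dotProduct]
    rw [sum_eq_sum_emb_real (F := fun q => pad w q * pad w q) (by simp [(pad_centre w).1]) (by simp [(pad_centre w).2])]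
    simp only [pad_emb]
  have h10 : (∑ p, |c p|) ^ 2 ≤ 10 * dotProduct c c := by
    have hcs := Finset.sum_mul_sq_le_sq_mul_sq Finset.univ (fun p : Fin 5 ⊕ Fin 5 => |c p|) (fun _ => (1 : ℝ))
    simp only [mul_one, one_pow, Finset.sum_const, Finset.card_univ, Fintype.card_sum, Fintype.card_fin,
      nsmul_eq_mul, sq_abs] at hcs
    have h10' : ((5 + 5 : ℕ) : ℝ) = 10 := by norm_num
    rw [h10'] at hcs
    simp only [dotProduct, ← pow_two]
    linarith
  -- `‖c₁‖² ≤ ‖w‖²/η²`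
  have h1 : dotProduct c₁ c₁ ≤ dotProduct w w / η ^ 2 := by
    rw [le_div_iff₀ (by positivity), ← hww, mul_comm]
    exact normSq_smInvInf_le A hsymm hA hs0 η hη hcnd (pad w)
  -- `‖c₂‖² ≤ X²‖w‖²/s₋²`
  have h2 : dotProduct c₂ c₂ ≤ X ^ 2 / sl ^ 2 * dotProduct w w := by
    have hxx : 0 ≤ dotProduct x x := Finset.sum_nonneg fun i _ => mul_self_nonneg _
    have hX0 : 0 ≤ X := hxx.trans hX
    have e : dotProduct c₂ c₂ = κ ^ 2 * dotProduct x x := by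
      rw [hc₂, smul_dotProduct, dotProduct_smul, smul_eq_mul, smul_eq_mul]; ring
    have hκ2 : κ ^ 2 ≤ dotProduct x x * dotProduct w w / sl ^ 2 := by
      have hcs : (dotProduct x (pad w)) ^ 2 ≤ dotProduct x x * dotProduct (pad w) (pad w) := by
        have := Finset.sum_mul_sq_le_sq_mul_sq Finset.univ x (pad w)
        simp only [dotProduct, pow_two] at this ⊢
        exact this
      rw [hww] at hcs
      have hden : sl ≤ s * (Λ * s - 1) := by nlinarith
      have hden2 : sl ^ 2 ≤ (s * (Λ * s - 1)) ^ 2 := pow_le_pow_left₀ hsl.le hden 2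
      rw [hκ, div_pow]
      have hnum : 0 ≤ dotProduct x x * dotProduct w w := mul_nonneg hxx (hww ▸ Finset.sum_nonneg fun i _ => mul_self_nonneg _)
      calc (dotProduct x (pad w)) ^ 2 / (s * (Λ * s - 1)) ^ 2 ≤ (dotProduct x x * dotProduct w w) / (s * (Λ * s - 1)) ^ 2 :=
            div_le_div_of_nonneg_right hcs (by positivity)
        _ ≤ dotProduct x x * dotProduct w w / sl ^ 2 := div_le_div_of_nonneg_left hnum (by positivity) hden2
    rw [e]
    have hw0 : 0 ≤ dotProduct w w := Finset.sum_nonneg fun i _ => mul_self_nonneg _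
    calc κ ^ 2 * dotProduct x x ≤ (dotProduct x x * dotProduct w w / sl ^ 2) * dotProduct x x :=
          mul_le_mul_of_nonneg_right hκ2 hxx
      _ = (dotProduct x x) ^ 2 / sl ^ 2 * dotProduct w w := by ring
      _ ≤ X ^ 2 / sl ^ 2 * dotProduct w w := by
          have : (dotProduct x x) ^ 2 ≤ X ^ 2 := pow_le_pow_left₀ hxx hX 2
          exact mul_le_mul_of_nonneg_right (div_le_div_of_nonneg_right this (by positivity)) hw0
  have hy := normSq_add_le c₁ c₂ θ hθ
  rw [← hdec] at hy
  have hw0 : 0 ≤ dotProduct w w := Finset.sum_nonneg fun i _ => mul_self_nonneg _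
  have hθ1 : 0 ≤ 1 + 1 / θ := by positivity
  calc (∑ p, |c p|) ^ 2 ≤ 10 * dotProduct c c := h10
    _ ≤ 10 * ((1 + θ) * dotProduct c₁ c₁ + (1 + 1 / θ) * dotProduct c₂ c₂) := by linarith
    _ ≤ 10 * ((1 + θ) * (dotProduct w w / η ^ 2) + (1 + 1 / θ) * (X ^ 2 / sl ^ 2 * dotProduct w w)) := by
        have a1 := mul_le_mul_of_nonneg_left h1 (show 0 ≤ 1 + θ by linarith)
        have a2 := mul_le_mul_of_nonneg_left h2 hθ1
        linarith
    _ = 10 * ((1 + θ) / η ^ 2 + (1 + 1 / θ) * X ^ 2 / sl ^ 2) * dotProduct w w := by ring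

end Generic

end TwoHoleBS

end Summit.HubbardSuperconductivity.HubbardSuperconductivity.Theorems.AnisotropyChord.Transfer.Fibre3
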